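import Literature.AlgebraicGeometry.ShimuraVarieties.UnitaryShimuraComplexGaloisDatumAssembly
import HarnessLib

/-!
# The Galois-twist predicate on morphisms of the complex unitary Shimura tower ([Deligne 1971] Prop. 5.10, complex half —
# packaging for the descent step)

Topic `AlgebraicGeometry/ShimuraVarieties`; namespace `Literature.AlgebraicGeometry.ShimuraVarieties.UnitaryCanonicalModel`,
sub-namespace `ComplexRecordSystem` (sequel of `UnitaryShimuraComplexGaloisDatum` ∕ `…Assembly`).  ONE definition with body
— the PREDICATE `ComplexRecordSystem.IsTwist Sc K σ u` on a morphism `u` of the complex level scheme `(Sc.Mc_K).left` (a predicate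
with parameters, D-0014: nothing is asserted) — and its theorem API.  Cell `hodgecm-mathlib` (D-0151), row I-6
`descentToIntersection_printed`, crew piece «D4-Tw» (lead A-p08, 2026-08-28T06:54:37Z): the generic descent machinery
(`Motives/GaloisDescentDatumOfTwists`) is parametrised by an abstract twist predicate `Tw K σ u` with hypotheses
uniqueness ∕ identity ∕ composition ∕ inverse ∕ naturality ∕ «the transported `gal` of every form is a twist» ∕ existence on
`Aut(ℂ/⋂Eᵢ)`; this file supplies that predicate for the unitary tower and discharges each hypothesis from the landed theorems.
Net Literature debt 0 (no named fact).

## The predicate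

`IsTwist Sc K σ u` (for a ring automorphism `σ` of `ℂ` and `u : (Sc.Mc_K).left ⟶ (Sc.Mc_K).left`) := `σ` fixes `τ(L)` ∧ `u` is an
isomorphism ∧ `u` covers `Spec σ⁻¹` (`u ≫ p = p ≫ Spec σ⁻¹`) ∧ for EVERY Artin correspondent `s` of `σ`, EVERY diagonal special pair
`(v₃, x₀)` and EVERY twist `d` by `r_{x₀}(s)`: `Spec σ ≫ P_{x₀,a} ≫ u = P_{x₀, d·a}` on the Hecke orbit — Shimura reciprocity (62)
([Milne2005ShimuraVarieties] Def. 12.8) for the semilinear point action of `u`.  (Invertibility is part of the predicate: the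
uniqueness argument — density of ONE Hecke orbit, [Milne2005ShimuraVarieties] Lemma 13.5 — compares `v⁻¹ ≫ u` with the identity on
genuine complex points; all twists that occur — transported Galois automorphisms and their composites — are isomorphisms.)

## API (all from `UnitaryShimuraComplexGaloisDatum{,Assembly}`)

`IsTwist.eq` (uniqueness), `IsTwist.id` (`σ = 1`), `IsTwist.comp` (`σρ ↦ v ≫ u`), `IsTwist.inv` (an inverse twist for `σ⁻¹`), `IsTwist.natural` (commutes with
the transition morphisms), `IsTwist.gal_transport` (the `e`-conjugate of `GaloisDescent.gal` of an `E`-form with reciprocity, in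
the canonical-instance currency `E : IntermediateField ℚ ℂ`, `σ : ℂ ≃ₐ[E] ℂ`), `IsTwist.exists_of_forall_mem_iInf` (a twist for every
`σ ∈ Aut(ℂ/⋂Eᵢ)` from a finite family of forms).

HC_CM is proved only modulo the 7 printed citations until rung 0 closes; this file discharges none of them by itself.

## References
* [Deligne1971TravauxShimura] P. Deligne, *Travaux de Shimura*, Sém. Bourbaki 389 (1971): Prop. 5.10 and Lemme 5.10.1 (pp. 157–158).
* [Milne2005ShimuraVarieties] J. S. Milne, *Introduction to Shimura varieties* (2005/2017): Def. 12.8 (62) p. 114, Lemma 13.5,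
  Thm. 13.6 p. 118, Prop. 13.1 p. 117.
-/

set_option autoImplicit false

noncomputable section

open Function MulAction Topology NumberField IsDedekindDomain CategoryTheory CategoryTheory.Limits Matrix
  AlgebraicGeometry Cardinal
open scoped Matrix ComplexOrder
open Literature.AlgebraicGeometry.Motives
open Literature.NumberTheory.Automorphic Literature.NumberTheory.Automorphic.UnitaryGroup
open Literature.NumberTheory.Automorphic.Liu2021.AppendixC (C5.OpenCompactSubgroup C5.SmallLevel)
open Literature.Geometry.ComplexHyperbolic Literature.Geometry.ComplexHyperbolic.BallModel
open Literature.NumberTheory.Automorphic.ShimuraDissection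

namespace Literature.AlgebraicGeometry.ShimuraVarieties.UnitaryCanonicalModel

variable {L : Type} [Field L] [NumberField L] [IsCMField L] {H : Matrix (Fin 3) (Fin 3) L}
  {τ : L →+* ℂ} {T : GL (Fin 3) ℂ} {hT : formCongr (starRingEnd ℂ) T (H.map τ) = BallModel.J}
  {K₀ : C5.OpenCompactSubgroup ↥(finAdelic (↥(maximalRealSubfield L)) L (IsCMField.complexConj L) 3 H)}

namespace ComplexRecordSystem

/-! ### §1. The predicate -/

/-- **Galois twist morphisms of the complex tower** ([Deligne1971TravauxShimura] Prop. 5.10 proof, the datum on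
`M_ℂ(G,h)`; [Milne2005ShimuraVarieties] Thm. 13.6 ∕ Def. 12.8 (62)): `IsTwist Sc K σ u` says that the ring automorphism `σ` of `ℂ`
fixes `τ(L)`, that `u : (Sc.Mc_K).left ⟶ (Sc.Mc_K).left` is an isomorphism of schemes covering `Spec σ⁻¹`, and that its semilinear
point action `P ↦ Spec σ ≫ P ≫ u` is Shimura reciprocity (62) on the Hecke orbit of the CM point of EVERY negative `L`-line, for
EVERY Artin correspondent `s` of `σ` and twist `d` by `r_{x₀}(s)`: `Sc.pts⁻¹[x₀, aK] ↦ Sc.pts⁻¹[x₀, d·aK]`.  A predicate (definition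
with body, parameters `Sc K σ u`); nothing is asserted. [cite: Deligne1971TravauxShimura, Prop. 5.10 (p. 157)]
[cite: Milne2005ShimuraVarieties, Def. 12.8 (62) p. 114; Thm. 13.6 p. 118] -/
def IsTwist (Sc : ComplexRecordSystem L H τ T hT K₀) (K : C5.SmallLevel K₀) (σ : ℂ ≃+* ℂ)
    (u : (Sc.Mc.obj K).left ⟶ (Sc.Mc.obj K).left) : Prop :=
  (∀ x : L, σ (τ x) = τ x) ∧ IsIso u ∧
    u ≫ (Sc.Mc.obj K).hom = (Sc.Mc.obj K).hom ≫ Spec.map (CommRingCat.ofHom (σ.symm : ℂ →+* ℂ)) ∧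
      ∀ s : (FiniteAdeleRing (𝓞 L) L)ˣ, IsArtinCorrespondent L τ s σ →
        ∀ (v₃ : Fin 3 → L) (x₀ : Ball), IsLinePoint L τ T v₃ x₀ →
          ∀ d : finAdelic (↥(maximalRealSubfield L)) L (IsCMField.complexConj L) 3 H, IsDiagTwist L H v₃ (recipFactor L s) d →
            ∀ a : finAdelic (↥(maximalRealSubfield L)) L (IsCMField.complexConj L) 3 H,
              Spec.map (CommRingCat.ofHom (σ : ℂ →+* ℂ)) ≫
                  ((Sc.pts K).symm (ShimuraSet.mk L H τ T hT K.1.1 x₀ a)).toSpecHom ≫ u =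
                ((Sc.pts K).symm (ShimuraSet.mk L H τ T hT K.1.1 x₀ (d * a))).toSpecHom

/-- Unfolding of `IsTwist` (bookkeeping, `Iff.rfl`). [cite: Milne2005ShimuraVarieties, Def. 12.8 (62) p. 114] -/
theorem isTwist_iff (Sc : ComplexRecordSystem L H τ T hT K₀) (K : C5.SmallLevel K₀) (σ : ℂ ≃+* ℂ)
    (u : (Sc.Mc.obj K).left ⟶ (Sc.Mc.obj K).left) :
    IsTwist Sc K σ u ↔
      (∀ x : L, σ (τ x) = τ x) ∧ IsIso u ∧
        u ≫ (Sc.Mc.obj K).hom = (Sc.Mc.obj K).hom ≫ Spec.map (CommRingCat.ofHom (σ.symm : ℂ →+* ℂ)) ∧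
          ∀ s : (FiniteAdeleRing (𝓞 L) L)ˣ, IsArtinCorrespondent L τ s σ →
            ∀ (v₃ : Fin 3 → L) (x₀ : Ball), IsLinePoint L τ T v₃ x₀ →
              ∀ d : finAdelic (↥(maximalRealSubfield L)) L (IsCMField.complexConj L) 3 H,
                IsDiagTwist L H v₃ (recipFactor L s) d →
                ∀ a : finAdelic (↥(maximalRealSubfield L)) L (IsCMField.complexConj L) 3 H,
                  Spec.map (CommRingCat.ofHom (σ : ℂ →+* ℂ)) ≫
                      ((Sc.pts K).symm (ShimuraSet.mk L H τ T hT K.1.1 x₀ a)).toSpecHom ≫ u =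
                    ((Sc.pts K).symm (ShimuraSet.mk L H τ T hT K.1.1 x₀ (d * a))).toSpecHom :=
  Iff.rfl

/-! ### §2. Uniqueness, identity, composition, inverse, naturality -/

/-- **Uniqueness of the twist** ([Milne2005ShimuraVarieties] Thm. 13.6 pattern): two twists for the same `σ` at the same level
coincide — `galoisTwistAut_unique` at the CM point of a negative `L`-line (which exists: `exists_mem_negCone_embedding`,
`exists_unique_isLinePoint`) for an Artin correspondent of `σ` (which exists since `σ` fixes `τ(L)`).
[cite: Milne2005ShimuraVarieties, Thm. 13.6 p. 118 L29–41; Lemma 13.5] -/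
theorem IsTwist.eq {Sc : ComplexRecordSystem L H τ T hT K₀} {K : C5.SmallLevel K₀} {σ : ℂ ≃+* ℂ}
    {u v : (Sc.Mc.obj K).left ⟶ (Sc.Mc.obj K).left} (hu : IsTwist Sc K σ u) (hv : IsTwist Sc K σ v) : u = v := by
  obtain ⟨hfix, hui, hus, hup⟩ := hu
  obtain ⟨-, hvi, hvs, hvp⟩ := hv
  have hH : ∀ i j, cmConjRingHom L (H i j) = H j i := cmConjRingHom_apply_eq_of_formCongr_eq_J L H τ T hT
  obtain ⟨v₃, hv₃⟩ := exists_mem_negCone_embedding (H := H) hT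
  obtain ⟨x₀, hx₀⟩ := (exists_unique_isLinePoint L H τ T hT v₃ hv₃).exists
  obtain ⟨s, hs⟩ := exists_finiteIdele_isArtinCorrespondent L τ σ hfix
  obtain ⟨d, hd⟩ := exists_isDiagTwist_recipFactor (H := H) (v₃ := v₃) hH (hermForm_self_ne_zero_of_mem_negCone hv₃) s
  haveI := hui
  haveI := hvi
  have h := galoisTwistAut_unique Sc K σ hx₀ hs hs hd hd (asIso u) (asIso v) hus (hup s hs v₃ x₀ hx₀ d hd)
    hvs (hvp s hs v₃ x₀ hx₀ d hd)
  exact congrArg Iso.hom h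

/-- **The identity is the twist of `σ = 1`.** [cite: Milne2005ShimuraVarieties, Def. 12.8 (62) p. 114] -/
theorem IsTwist.id (Sc : ComplexRecordSystem L H τ T hT K₀) (K : C5.SmallLevel K₀) : IsTwist Sc K 1 (𝟙 _) := by
  have h1 : Spec.map (CommRingCat.ofHom ((1 : ℂ ≃+* ℂ).symm : ℂ →+* ℂ)) = 𝟙 _ := by
    have h : ((1 : ℂ ≃+* ℂ).symm : ℂ →+* ℂ) = RingHom.id ℂ := RingHom.ext fun _ => rfl
    rw [h, CommRingCat.ofHom_id]
    exact Spec.map_id _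
  refine ⟨fun x => rfl, inferInstance, by rw [h1, Category.id_comp, Category.comp_id], fun s hs v₃ x₀ hx₀ d hd a => ?_⟩
  exact galoisTwistAut_pt_of_pt Sc K 1 hx₀ (isArtinCorrespondent_one_one L τ) hs (IsDiagTwist.one_recipFactor v₃) hd
    (galoisTwistAut_one Sc K x₀).2 a

/-- **Composition of twists**: a twist `u` for `σ` and a twist `v` for `ρ` compose to the twist `v ≫ u` for `σρ` (the order of
`GaloisDescent.gal_mul`; reciprocity data multiply, `IsArtinCorrespondent.mul` ∕ `recipFactor_mul` ∕ `IsDiagTwist.mul`).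
[cite: Deligne1971TravauxShimura, Lemme 5.10.1 (p. 158)] [cite: Milne2005ShimuraVarieties, Def. 12.8 (62) p. 114] -/
theorem IsTwist.comp {Sc : ComplexRecordSystem L H τ T hT K₀} {K : C5.SmallLevel K₀} {σ ρ : ℂ ≃+* ℂ}
    {u v : (Sc.Mc.obj K).left ⟶ (Sc.Mc.obj K).left} (hu : IsTwist Sc K σ u) (hv : IsTwist Sc K ρ v) :
    IsTwist Sc K (σ * ρ) (v ≫ u) := by
  obtain ⟨hfix, hui, hus, hup⟩ := hu
  obtain ⟨hfix', hvi, hvs, hvp⟩ := hv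
  have hH : ∀ i j, cmConjRingHom L (H i j) = H j i := cmConjRingHom_apply_eq_of_formCongr_eq_J L H τ T hT
  haveI := hui
  haveI := hvi
  obtain ⟨s, hs⟩ := exists_finiteIdele_isArtinCorrespondent L τ σ hfix
  obtain ⟨s', hs'⟩ := exists_finiteIdele_isArtinCorrespondent L τ ρ hfix'
  refine ⟨fun x => by rw [RingAut.mul_apply, hfix' x, hfix x], inferInstance, ?_, fun s'' hs'' v₃ x₀ hx₀ d'' hd'' a => ?_⟩
  · obtain ⟨v₃, hv₃⟩ := exists_mem_negCone_embedding (H := H) hT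
    obtain ⟨x₀, hx₀⟩ := (exists_unique_isLinePoint L H τ T hT v₃ hv₃).exists
    have hv := hermForm_self_ne_zero_of_mem_negCone hv₃
    obtain ⟨d, hd⟩ := exists_isDiagTwist_recipFactor (H := H) (v₃ := v₃) hH hv s
    obtain ⟨d', hd'⟩ := exists_isDiagTwist_recipFactor (H := H) (v₃ := v₃) hH hv s'
    exact (galoisTwistAut_mul Sc K σ ρ x₀ (asIso u) (asIso v) hus (hup s hs v₃ x₀ hx₀ d hd) hvs
      (hvp s' hs' v₃ x₀ hx₀ d' hd')).1
  · have hv := hermForm_self_ne_zero_of_isLinePoint L H τ T hT hx₀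
    obtain ⟨d, hd⟩ := exists_isDiagTwist_recipFactor (H := H) (v₃ := v₃) hH hv s
    obtain ⟨d', hd'⟩ := exists_isDiagTwist_recipFactor (H := H) (v₃ := v₃) hH hv s'
    have hmul := (galoisTwistAut_mul Sc K σ ρ x₀ (asIso u) (asIso v) hus (hup s hs v₃ x₀ hx₀ d hd) hvs
      (hvp s' hs' v₃ x₀ hx₀ d' hd')).2
    have hdd : IsDiagTwist L H v₃ (recipFactor L (s * s')) (d * d') := by
      rw [recipFactor_mul]
      exact hd.mul hd'
    exact galoisTwistAut_pt_of_pt Sc K (σ * ρ) hx₀ (hs.mul τ hs') hs'' hdd hd'' hmul a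

/-- **Inverse of a twist**: the inverse of a twist for `σ` is the twist for `σ⁻¹`. [cite: Deligne1971TravauxShimura, Lemme 5.10.1 (p. 158)]
[cite: Milne2005ShimuraVarieties, Def. 12.8 (62) p. 114] -/
theorem IsTwist.inv {Sc : ComplexRecordSystem L H τ T hT K₀} {K : C5.SmallLevel K₀} {σ : ℂ ≃+* ℂ}
    {u : (Sc.Mc.obj K).left ⟶ (Sc.Mc.obj K).left} (hu : IsTwist Sc K σ u) :
    ∃ v : (Sc.Mc.obj K).left ⟶ (Sc.Mc.obj K).left, IsTwist Sc K σ⁻¹ v ∧ u ≫ v = 𝟙 _ ∧ v ≫ u = 𝟙 _ := by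
  obtain ⟨hfix, hui, hus, hup⟩ := hu
  have hH : ∀ i j, cmConjRingHom L (H i j) = H j i := cmConjRingHom_apply_eq_of_formCongr_eq_J L H τ T hT
  haveI := hui
  have hfix' : ∀ x : L, σ⁻¹ (τ x) = τ x := fun x => by
    have h := congrArg σ.symm (hfix x)
    rw [RingEquiv.symm_apply_apply] at h
    exact h.symm
  obtain ⟨s, hs⟩ := exists_finiteIdele_isArtinCorrespondent L τ σ hfix
  refine ⟨(asIso u).inv, ⟨hfix', inferInstance, ?_, fun s' hs' v₃ x₀ hx₀ d' hd' a => ?_⟩, (asIso u).hom_inv_id,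
    (asIso u).inv_hom_id⟩
  · obtain ⟨v₃, hv₃⟩ := exists_mem_negCone_embedding (H := H) hT
    obtain ⟨x₀, hx₀⟩ := (exists_unique_isLinePoint L H τ T hT v₃ hv₃).exists
    obtain ⟨d, hd⟩ := exists_isDiagTwist_recipFactor (H := H) (v₃ := v₃) hH (hermForm_self_ne_zero_of_mem_negCone hv₃) s
    exact (galoisTwistAut_symm Sc K σ x₀ (asIso u) hus (hup s hs v₃ x₀ hx₀ d hd)).1
  · obtain ⟨d, hd⟩ := exists_isDiagTwist_recipFactor (H := H) (v₃ := v₃) hH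
      (hermForm_self_ne_zero_of_isLinePoint L H τ T hT hx₀) s
    have hsymm := (galoisTwistAut_symm Sc K σ x₀ (asIso u) hus (hup s hs v₃ x₀ hx₀ d hd)).2
    exact galoisTwistAut_pt_of_pt Sc K σ⁻¹ hx₀ (hs.inv τ) hs' hd.inv_of_recipFactor hd' hsymm a

/-- **Twists commute with the transition morphisms of the tower** (`galoisTwistAut_natural`).
[cite: Deligne1971TravauxShimura, Prop. 5.10 proof (compatibility with the levels)] [cite: Milne2005ShimuraVarieties, Thm. 13.6 p. 118] -/
theorem IsTwist.natural {Sc : ComplexRecordSystem L H τ T hT K₀} {K K' : C5.SmallLevel K₀} (f : K ⟶ K') {σ : ℂ ≃+* ℂ}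
    {u : (Sc.Mc.obj K).left ⟶ (Sc.Mc.obj K).left} {u' : (Sc.Mc.obj K').left ⟶ (Sc.Mc.obj K').left}
    (hu : IsTwist Sc K σ u) (hu' : IsTwist Sc K' σ u') :
    u ≫ (Sc.Mc.map f).left = (Sc.Mc.map f).left ≫ u' := by
  obtain ⟨hfix, hui, hus, hup⟩ := hu
  obtain ⟨-, hui', hus', hup'⟩ := hu'
  have hH : ∀ i j, cmConjRingHom L (H i j) = H j i := cmConjRingHom_apply_eq_of_formCongr_eq_J L H τ T hT
  obtain ⟨v₃, hv₃⟩ := exists_mem_negCone_embedding (H := H) hT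
  obtain ⟨x₀, hx₀⟩ := (exists_unique_isLinePoint L H τ T hT v₃ hv₃).exists
  obtain ⟨s, hs⟩ := exists_finiteIdele_isArtinCorrespondent L τ σ hfix
  obtain ⟨d, hd⟩ := exists_isDiagTwist_recipFactor (H := H) (v₃ := v₃) hH (hermForm_self_ne_zero_of_mem_negCone hv₃) s
  haveI := hui
  haveI := hui'
  exact galoisTwistAut_natural Sc f σ (asIso u) (asIso u') hus (hup s hs v₃ x₀ hx₀ d hd) hus' (hup' s hs v₃ x₀ hx₀ d hd)

/-! ### §3. The transported `gal` of a form is a twist; twists exist on `Aut(ℂ/⋂Eᵢ)` -/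

/-- **The `e`-conjugate of `GaloisDescent.gal` of an `E`-form with reciprocity IS the twist of `σ`** (canonical-instance
currency `E : IntermediateField ℚ ℂ`, `σ : ℂ ≃ₐ[E] ℂ`, as the descent step reads it; [Deligne1979ShimuraVarieties] 2.2.5,
[Milne2005ShimuraVarieties] (62)): `galoisTwistAut_gal_transport`, plus invertibility of the composite of isomorphisms and
`σ|τ(L) = 1` from `τ(L) ⊆ E`. [cite: Deligne1979ShimuraVarieties, 2.2.4–2.2.5] [cite: Milne2005ShimuraVarieties, Def. 12.8 (62) p. 114; §13 p. 118 L21–26] -/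
theorem IsTwist.gal_transport (Sc : ComplexRecordSystem L H τ T hT K₀) (E : IntermediateField ℚ ℂ)
    (hτE : ∀ x : L, τ x ∈ E) (M : C5.SmallLevel K₀ ⥤ SchemeOver ↥E) (e : (M ⋙ Motives.baseChange ↥E ℂ) ≅ Sc.Mc)
    (hM : IsCanonicalDescentOver Sc (algebraMap ↥E ℂ) M e) (K : C5.SmallLevel K₀) (σ : ℂ ≃ₐ[↥E] ℂ) :
    IsTwist Sc K (σ : ℂ ≃+* ℂ) ((e.app K).inv.left ≫ GaloisDescent.gal ℂ (M.obj K) σ ≫ (e.app K).hom.left) := by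
  have hfix : ∀ x : L, (σ : ℂ ≃+* ℂ) (τ x) = τ x := fun x => σ.commutes ⟨τ x, hτE x⟩
  obtain ⟨s, hs⟩ := exists_finiteIdele_isArtinCorrespondent L τ (σ : ℂ ≃+* ℂ) hfix
  have h := galoisTwistAut_gal_transport Sc (algebraMap ↥E ℂ) M e hM K (σ : ℂ ≃+* ℂ) (fun x => σ.commutes x) hs
  refine ⟨hfix, ?_, h.1, fun s' hs' v₃ x₀ hx₀ d' hd' a => ?_⟩
  · -- the composite is the underlying morphism of the isomorphism `e_K⁻¹ ≪≫ (1 × Spec σ⁻¹) ≪≫ e_K`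
    let galIso : GaloisDescent.bc ℂ (M.obj K) ≅ GaloisDescent.bc ℂ (M.obj K) :=
      ⟨GaloisDescent.gal ℂ (M.obj K) σ, GaloisDescent.gal ℂ (M.obj K) σ⁻¹,
        GaloisDescent.gal_comp_gal_symm ℂ (M.obj K) σ, GaloisDescent.gal_symm_comp_gal ℂ (M.obj K) σ⟩
    let eL : GaloisDescent.bc ℂ (M.obj K) ≅ (Sc.Mc.obj K).left := (Over.forget _).mapIso (e.app K)
    change IsIso (eL.symm ≪≫ galIso ≪≫ eL).hom
    infer_instance
  · have hH : ∀ i j, cmConjRingHom L (H i j) = H j i := cmConjRingHom_apply_eq_of_formCongr_eq_J L H τ T hT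
    obtain ⟨d, hd⟩ := exists_isDiagTwist_recipFactor (H := H) (v₃ := v₃) hH
      (hermForm_self_ne_zero_of_isLinePoint L H τ T hT hx₀) s
    exact galoisTwistAut_pt_of_pt Sc K (σ : ℂ ≃+* ℂ) hx₀ hs hs' hd hd' (h.2 v₃ x₀ hx₀ d hd) a

/-- **Twists exist on the subgroup generated by the `Aut(ℂ/Eᵢ)`** of a family of forms `(Mᵢ, eᵢ)` over number fields
`Eᵢ ∋ τ(L)` with reciprocity over `Eᵢ` — closure induction: generators by `IsTwist.gal_transport`, then `IsTwist.id ∕ .comp ∕ .inv`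
([Deligne1971TravauxShimura] Prop. 5.10 proof, the datum on `M_ℂ(G,h)` extended multiplicatively from the `Gal(F/Eᵢ)`).
[cite: Deligne1971TravauxShimura, Prop. 5.10 and Lemme 5.10.1 (pp. 157–158)] [cite: Milne2005ShimuraVarieties, Def. 12.8 (62) p. 114] -/
theorem IsTwist.exists_of_mem_closure (Sc : ComplexRecordSystem L H τ T hT K₀) {ι : Type}
    (Ei : ι → IntermediateField ℚ ℂ) (hτ : ∀ (i : ι) (x : L), τ x ∈ Ei i)
    (hMi : ∀ i : ι, ∃ (M : C5.SmallLevel K₀ ⥤ SchemeOver ↥(Ei i)) (e : (M ⋙ Motives.baseChange ↥(Ei i) ℂ) ≅ Sc.Mc),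
      IsCanonicalDescentOver Sc (algebraMap ↥(Ei i) ℂ) M e)
    (σ : ℂ ≃+* ℂ) (hσ : σ ∈ Subgroup.closure (⋃ i : ι, {ρ : ℂ ≃+* ℂ | ∀ x : ↥(Ei i), ρ x = x})) (K : C5.SmallLevel K₀) :
    ∃ u : (Sc.Mc.obj K).left ⟶ (Sc.Mc.obj K).left, IsTwist Sc K σ u := by
  revert K
  induction hσ using Subgroup.closure_induction with
  | mem ρ hρ =>
    intro K
    obtain ⟨i, hi⟩ := Set.mem_iUnion.mp hρ
    obtain ⟨M, e, hM⟩ := hMi i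
    exact ⟨_, IsTwist.gal_transport Sc (Ei i) (hτ i) M e hM K (AlgEquiv.ofRingEquiv (f := ρ) fun x => hi x)⟩
  | one =>
    intro K
    exact ⟨𝟙 _, IsTwist.id Sc K⟩
  | mul ρ ρ' _ _ ih ih' =>
    intro K
    obtain ⟨u, hu⟩ := ih K
    obtain ⟨v, hv⟩ := ih' K
    exact ⟨v ≫ u, hu.comp hv⟩
  | inv ρ _ ih =>
    intro K
    obtain ⟨u, hu⟩ := ih K
    obtain ⟨v, hv, -, -⟩ := hu.inv
    exact ⟨v, hv⟩

/-- **Twists exist for every `σ ∈ Aut(ℂ/⋂Eᵢ)`** (finite nonempty family of forms over number fields `Eᵢ ∋ τ(L)` with reciprocity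
over `Eᵢ`): `IsTwist.exists_of_mem_closure` + the generation theorem `Aut(ℂ/⋂Eᵢ) = ⟨⋃ Aut(ℂ/Eᵢ)⟩` (the tree's
`Complex.ringEquiv_induction_of_eq_iInf`).  This is hypothesis «existence» of the descent machinery for the complex unitary tower.
[cite: Deligne1971TravauxShimura, Prop. 5.10 and Lemme 5.10.1 (pp. 157–158)] [cite: Milne2005ShimuraVarieties, Def. 12.8 (62) p. 114] -/
theorem IsTwist.exists_of_forall_mem_iInf (Sc : ComplexRecordSystem L H τ T hT K₀) {ι : Type} [Finite ι] [Nonempty ι]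
    (Ei : ι → IntermediateField ℚ ℂ) [∀ i, FiniteDimensional ℚ ↥(Ei i)] (hτ : ∀ (i : ι) (x : L), τ x ∈ Ei i)
    (hMi : ∀ i : ι, ∃ (M : C5.SmallLevel K₀ ⥤ SchemeOver ↥(Ei i)) (e : (M ⋙ Motives.baseChange ↥(Ei i) ℂ) ≅ Sc.Mc),
      IsCanonicalDescentOver Sc (algebraMap ↥(Ei i) ℂ) M e)
    (σ : ℂ ≃+* ℂ) (hσ : ∀ x : ↥(⨅ i, Ei i), σ x = x) (K : C5.SmallLevel K₀) :
    ∃ u : (Sc.Mc.obj K).left ⟶ (Sc.Mc.obj K).left, IsTwist Sc K σ u := by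
  have hmem : σ ∈ Subgroup.closure (⋃ i : ι, {ρ : ℂ ≃+* ℂ | ∀ x : ↥(Ei i), ρ x = x}) :=
    Literature.FieldTheory.AlgClosed.Complex.ringEquiv_induction_of_eq_iInf Ei (⨅ i, Ei i) rfl
      (p := fun ρ : ℂ ≃+* ℂ => ρ ∈ Subgroup.closure (⋃ i : ι, {ρ : ℂ ≃+* ℂ | ∀ x : ↥(Ei i), ρ x = x}))
      (fun i ρ hρ => Subgroup.subset_closure (Set.mem_iUnion.mpr ⟨i, fun x => hρ x.1 x.2⟩))
      (fun ρ ρ' h h' => Subgroup.mul_mem _ h h') σ hσ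
  exact IsTwist.exists_of_mem_closure Sc Ei hτ hMi σ hmem K

end ComplexRecordSystem

end Literature.AlgebraicGeometry.ShimuraVarieties.UnitaryCanonicalModel

end
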